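import Mathlib
import HarnessLib
import HarnessLib.Audit

/-!
# DefinableTranslateRecurrenceLC

Topic `Literature/ModelTheory/PseudofiniteFields`. Named literature fact(s) relocated by the gate from `Summits/MatrixMultiplication/MatrixMultiplication/Theorems/PairwiseCurvedTilingsLC/Negative/PairwiseCurvedTilingsLCFalseOfDefinableTranslateRecurrenceLC.lean`
(accept-time relocation of `[cite]`d propositions written inline in a Summits proposal; human ruling 2026-08-15).

* `Literature.ModelTheory.PseudofiniteFields.DefinableTranslateRecurrenceLC` ("H") — a statement POSED in
  this tree (crux-ideate card of `stmt-MatrixMultiplication-17883`; no publication states it) and PROVED in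
  this tree CONDITIONALLY on three published named facts of this directory:
  `DefinableTranslateRecurrenceLC_of_facts : JohnsonTranWalsbergYe2024_thm71_psf → WalsbergYe2023_thmC_psf →
  ChatzidakisVanDenDriesMacintyre1992_mainTheorem → DefinableTranslateRecurrenceLC`
  (`DefinableTranslateRecurrenceLCProofs.lean`, 2026-08-17, through the dimension theory of definable sets over
  pseudo-finite fields of `CountingDimension.lean`, `CountingDimensionThresholds.lean`,
  `CountingDimensionDefinable.lean`, `SmoothLocusDimension.lean`).  STATUS: CONDITIONAL — trust base
  {WalsbergYe2023 Thm C/D, JohnsonTranWalsbergYe2024 Thm 7.1, CDM 1992 Main Theorem (itself conditional on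
  CDM Prop. 2.7 and 3.3)}; `DefinableTranslateRecurrenceLC_holds` follows from `…_of_facts` once those facts
  are discharged.  It is kept as a `def … : Prop` (not renamed) because two `Summits/MatrixMultiplication`
  theorem files import this module and take `(h : DefinableTranslateRecurrenceLC)` as a hypothesis; they are
  fed `DefinableTranslateRecurrenceLC_of_facts h71 hWY hCDM`.  History: registered 2026-08-15 with a
  derivation SKETCH through Galois stratification (Kiefe 1976 / Fried–Jarden Ch. 30) and uniform Chebotarev
  (Katz–Sarnak 9.7.13); tagged `@[conjecture]` [status: open] on 2026-08-17 (no published proof); the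
  in-tree conditional proof of 2026-08-17 is a different argument (étale-open topology + CDM counting), and the
  tag was removed then.  Statement byte-for-byte unchanged throughout.
-/

namespace Literature.ModelTheory.PseudofiniteFields

open Finset
open FirstOrder FirstOrder.Language

/-- [status: conditional — proved in this tree from three published named facts,
`DefinableTranslateRecurrenceLC_of_facts` in `DefinableTranslateRecurrenceLCProofs.lean`] —
**`H`: translate recurrence for definable sets over finite fields of large characteristic.**
A statement POSED in this tree, not a vendored theorem (no publication states it): it is
crux-ideate k=2's "conjecture-shaped named fact" `DefinableTranslateRecurrence` of item
`stmt-MatrixMultiplication-17883`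
(`Summits/MatrixMultiplication/MatrixMultiplication/Cruxes/PairwiseCurvedTilingsLC/ChebotarevRecurrenceSketch.lean`),
vendored here verbatim except that the threshold is on the CHARACTERISTIC, `Q ≤ ringChar F`,
instead of `Q ≤ |F|` (the regime of the crux, implied by the all-characteristic form since
`ringChar F ≤ |F|`).  In-tree users (why it is a `def … : Prop` taken as a hypothesis): the
negative lemma
`PairwiseCurvedTilingsLC_false_of_DefinableTranslateRecurrenceLC : DefinableTranslateRecurrenceLC → ¬ PairwiseCurvedTilingsLC`
(`…/Theorems/PairwiseCurvedTilingsLC/Negative/PairwiseCurvedTilingsLCFalseOfDefinableTranslateRecurrenceLC.lean`)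
and `noLonely_of_definableTranslateRecurrenceLC`, `HexagonClearanceR_of_definableTranslateRecurrenceLC`
(`…/Theorems/DefinableSTPPDichotomyHexagonClearanceROfRecurrence.lean`); feed them
`DefinableTranslateRecurrenceLC_of_facts h71 hWY hCDM`.
STATEMENT.  For ring formulas `τ(w; ȳ)` (`w ∈ F^m`, `ȳ ∈ F^n`) and `α(v; ȳ')` (`v ∈ F^m`,
`ȳ' ∈ F^{n'}`) there are `Q, K ∈ ℕ` and `C, c ∈ ℝ`, `c > 0`, such that for every finite field `F`
of characteristic `≥ Q` and every `ȳ` there is `E ⊆ F^m` with `|E| ≤ C|F|^{m−1}` (depending on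
`τ, ȳ` only) such that for every `ȳ'`, writing `T := τ(F^m; ȳ)`, `A := α(F^m; ȳ')`: if `|A| > K`
then every `t ∈ T ∖ E` satisfies `c|A|² ≤ #{(a₀, a) ∈ A × A : t + a − a₀ ∈ T}`.
PROOF IN THE TREE (conditional; `DefinableTranslateRecurrenceLCProofs.lean`).  Write
`Fib_t(a₀) = {a ∈ A | t + a − a₀ ∈ T}` and `Exc_e(t) = {a₀ ∈ A | dim Fib_t(a₀) < e}` for the
fibre-counting dimension of definable sets (`CountingDimension*.lean`; it agrees with the CDM
dimension and is first-order, by [ChatzidakisVanDenDriesMacintyre1992, Main Theorem] and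
transfer).  (1) In a pseudo-finite field, if `t` is étale-interior in `T` then `dim Exc_e(t) < e`
for all `e ≥ 1`: decompose `Exc_e(t)` into étale-open subsets of smooth loci
[WalsbergYe2023, Thm C (1), Thm D]; a piece of dimension `≥ e` lies in a locus `V` of codimension
`c` with `e ≤ m − c`; for `a₀` in it, the translate of an étale neighbourhood of `t` inside `T`
meets the piece in an étale-open subset of `V` through `a₀` contained in `Fib_t(a₀)`, which
therefore has dimension `≥ m − c ≥ e` (no smooth point of a positive-dimensional locus is
étale-isolated, [JohnsonTranWalsbergYe2024, Thm 7.1]; slicing induction,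
`SmoothLocusDimension.lean`) — contradiction.  (2) Generic points of `T` are étale-interior off a
hypersurface; "every `t ∈ T` off a box polynomial of degree `≤ N` is good for all `ȳ'`" is one
ring sentence true in all pseudo-finite fields for some `N`; compactness and transfer move it to
all finite fields with `|F| ≥ q₀`.  (3) Counting in `F`: `E :=` zeros of the box polynomial
(Schwartz–Zippel); with `e` the thresholded dimension of `A` (`δ_A^m q^e ≤ |A| ≤ M_A q^e`, `e ≥ 1`
as `|A| > K := M_A`), goodness gives `|Exc_e(t)| ≤ M_E q^{e−1} ≤ |A|/2` and
`|Fib_t(a₀)| ≥ δ_F^m q^e` off `Exc_e(t)`, so `Σ_{a₀} |Fib_t(a₀)| ≥ c|A|²`,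
`c = δ_A^m δ_F^m / (2M_A²)`.  Degenerate case `m = 0`: `|A| ≤ 1`.
The original derivation SKETCH of the card (Galois stratification of `τ, α` [Kiefe1976;
Fried–Jarden Ch. 30], Lang–Weil, uniform Chebotarev [KatzSarnak1998, Thm 9.7.13]) is not the
route formalised.
INGREDIENTS of the in-tree proof (none of them states the displayed statement):
[cite: WalsbergYe2023, Thm C (1) and Thm D] [cite: JohnsonTranWalsbergYe2024, Thm 7.1 and Thm A]
[cite: ChatzidakisVanDenDriesMacintyre1992, Main Theorem and (2.7)]
[topic ModelTheory/PseudofiniteFields] -/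
def DefinableTranslateRecurrenceLC : Prop :=
  open scoped Classical in
  ∀ (m n n' : ℕ) (τ : FirstOrder.Language.ring.Formula (Fin m ⊕ Fin n))
    (α : FirstOrder.Language.ring.Formula (Fin m ⊕ Fin n')),
    ∃ (Q K : ℕ) (C c : ℝ), 0 < c ∧
      ∀ (F : Type) [Field F] [Fintype F] [FirstOrder.Ring.CompatibleRing F],
        Q ≤ ringChar F → ∀ (y : Fin n → F), ∃ E : Finset (Fin m → F),
          (E.card : ℝ) ≤ C * (Fintype.card F : ℝ) ^ ((m : ℝ) - 1) ∧
          ∀ (y' : Fin n' → F) (T A : Finset (Fin m → F)),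
            (∀ w, w ∈ T ↔ τ.Realize (Sum.elim w y)) →
            (∀ v, v ∈ A ↔ α.Realize (Sum.elim v y')) →
            K < A.card → ∀ t ∈ T, t ∉ E →
              c * (A.card : ℝ) ^ 2 ≤
                (((A ×ˢ A).filter fun p : (Fin m → F) × (Fin m → F) => t + p.2 - p.1 ∈ T).card : ℝ)

end Literature.ModelTheory.PseudofiniteFields
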